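import Literature.MathematicalPhysics.QuantumFieldTheory.Balaban1983to89.Beta.AffineReproduction

/-!
# Beta/BlochFibreUniqueness — the homogeneous BLOCH-FIBRE KKT system of the gauge-fixed, block-averaged
quadratic variational problem on `ℤ^d` has only the trivial solution, in EVERY fibre (every unitary character)

HONEST FRAMING (cell `pub-balaban`, β sub-cell, row BETA-an2 gen 5; binding, verbatim): «discharging BetaPertH makes
Balaban's UV stability UNCONDITIONAL — a real constructive-QFT result; it is NOT the continuum limit and NOT the Clay
problem.»  This module is [folklore] finite-dimensional linear algebra (one Bloch fibre at a time) on the lattice `ℤ^d`;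
NOTHING of the manuscripts under audit is asserted or cited as a fact; nothing of the wall (M2⁺) is discharged by it.
Value = kernel uniqueness leaf of the cell's kernel route P1-K to the `InfiniteVolumeSpec` instance, NOT summit progress;
NOT continuum, NOT Clay.

CONTEXT (cell records, not literature: HOME/BETA/AN2.md §11 (Y15)(b), (Y18); lead's RULING (R13) / route question P1-K).
`AffineReproduction.InfiniteVolumeSpec d N` types the infinite-volume, gauge-fixed linearised minimiser with prescribed
straight-contour block sums as pointwise algebra; its one-block-torus (quasi-momentum ZERO) uniqueness is KERNEL
(`OneBlockTorusKKT.oneBlock_uniqueness_of_lap_gauge`, via `OneBlockTorusUniqueness.hdg_holds`).  The kernel route to an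
INSTANCE by Fourier analysis over the sublattice `N•ℤ^d` needs the fibre operator to be NONSINGULAR AT EVERY quasi-momentum,
i.e. the statement of this file: a solution `(A, φ, μ)` of the HOMOGENEOUS system that is `χ`-Bloch (quasi-periodic) for a
unitary `χ` vanishes.  The two cohomological / harmonic inputs for a NON-trivial character are lit2's KERNEL theorems
`LatticeForm.exists_isBloch_primitive` (twisted `H¹ = 0`) and `LatticeForm.IsBloch.eq_zero_of_lap_eq_zero` (no Bloch waves of
non-zero quasi-momentum in `ker Δ`); for the trivial character `LatticeForm.exists_const_add_d₀_of_periodic` and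
`LatticeForm.apply_eq_of_periodic_of_lap_eq_zero` (`BlochPeriodicCochains.lean`).  The rest is summation by parts over ONE
fundamental box, valid because products `conj u · v` of two `χ`-Bloch fields with `‖χ‖ = 1` are `N`-PERIODIC.

THE SYSTEM (unknowns: fine 1-form `A`, coarse 1-form `φ` = constraint multiplier, fine 0-form `μ` = gauge multiplier with
zero block mean; `Δ′ := codiff₁ ∘ dz = −Δ`):
  (EL)  `curvAdj (curv A) = adjContourSum N φ + dz (codiff₁ (dz μ))`      (Euler–Lagrange: `δd A = 𝒬ᵀφ + d Δ′μ`)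
  (Q)   `contourSum N A κ 0 = 0`                                          (homogeneous constraint; all blocks follow by Bloch)
  (G)   `codiff₁ (dz (codiff₁ A))` constant on the block of `0`            (the WEAK gauge «`Δ′ δA` block-constant» = `R δA = 0`)
  (M)   `blockSum N μ 0 = 0`                                              (the multiplier lives in `N(Q′)`: zero block means)
with `A κ`, `μ` `χ`-Bloch w.r.t. `N•ℤ^d` and `φ κ` `χ`-Bloch w.r.t. `ℤ^d` (`IsBloch 1`).  CONCLUSION (`blochFibre_uniqueness`):
`A = 0 ∧ φ = 0 ∧ μ = 0`.

PROOF (all fibres at once; [folklore]).  Pair (EL) with `A` over the box: `‖curv A‖² = ⟨𝒬A, φ⟩ + ⟨Δ′ δA, μ⟩ = 0 + 0`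
((Q); (G) against (M)) ⟹ `curv A = 0` ⟹ `A = dz λ` with `λ` `χ`-Bloch and `blockSum N λ 0 = 0` (twisted `H¹ = 0`, resp.
`const + exact` with the constant killed by (Q) and the primitive normalised, using `contourSum_dz`: `𝒬 ∘ dz = dz ∘ blockSum`);
then `δA = Δ′λ` and (G) paired with `λ` gives `‖Δ′λ‖² = 0` ⟹ `Δλ = 0` ⟹ `λ = 0` (resp. constant) ⟹ `A = 0`; then (EL) reads
`𝒬ᵀφ + dz Δ′μ = 0`, paired with `dz μ`: `⟨dz (blockSum μ), φ⟩ + ‖Δ′μ‖² = 0` with `blockSum μ ≡ 0` by (M) + Bloch ⟹ `Δμ = 0`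
⟹ `μ = 0` ⟹ `𝒬ᵀφ = 0` ⟹ `φ = 0` (evaluate `𝒬ᵀφ` at the far corner of a block: `= N · φ`).

WHAT THIS FILE PROVES ([folklore], over `ℂ`): §1 box sums over a fundamental domain indexed by the discrete torus
(`bsum`, `sum_box_toSite_eq_bsum`, shift invariance `bsum_shift` for `N`-periodic summands); §2 Bloch closure of the
stencils (`isBloch_shift/add/sub/sum/mul_left`, `isBloch_dz/codiff₁/curv/lapN/adjContourSum`, coarse Bloch-ness of
`blockSum`/`contourSum`), periodicity of `conj u · v`; §3 the box pairings `ip0/ip1/ip2`, conjugate symmetry, positivity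
(`ip0_self_eq_zero_iff`, …), Bloch extension from the box (`isBloch_eq_zero_of_box`); §4 ADJOINTNESS on Bloch fields:
`ip0_fd` (directional), `ip1_dz`/`ip1_dz_left` (`⟨B, dz f⟩ = ⟨codiff₁ B, f⟩`), `ip2_curv` (`⟨F, curv A⟩ = ⟨curvAdj F, A⟩`),
`ip0_lapN_left/right` (`Δ′` symmetric), `ip1_adjContourSum'` (`⟨A, 𝒬ᵀφ⟩ = Σ_κ conj (𝒬A κ 0) · φ κ 0`); §5 the generic adjoint block sum
`adjContourSum` (`= AffineReproduction.contourSumAdj` over `ℝ`, `adjContourSum_real`) and its far-corner evaluation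
`adjContourSum_corner`; §6 the steps `curv_eq_zero_of_system`, `exists_primitive`, `lap_eq_zero_of_gauge`,
`dz_eq_zero_of_lap`, `eq_zero_of_lap_of_bsum`, then **`blochFibre_uniqueness`**, the multiplier-free corollary
`blochFibre_field_eq_zero` and the inhomogeneous form `blochFibre_solution_unique` (two solutions with the same data coincide).

WHAT THIS FILE DOES NOT DO.  No existence / instance (the fibre operator's invertibility follows fibrewise by finite
dimension, and the `ℤ^d` kernel by Fourier synthesis over the Brillouin zone with strip analyticity — the cell's (D4), NOT
here); no decay; no identification with Bałaban's operators (the system is the cell's typing of the gauge-fixed linearised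
problem, AN2 (Y15)(b), recorded as a READING); no cited facts.  For the trivial character the statement is a `ℤ^d`-side
twin of the torus theorem `oneBlock_uniqueness_of_lap_gauge` with the multiplier in the `N(Q′)`-form `dz Δ′μ`.

Version v1 (2026-08-19, b2b-balaban-beta-an2-g5).  value = kernel uniqueness leaf, NOT summit progress.
-/

namespace Literature.MathematicalPhysics.QuantumFieldTheory.Balaban1983to89.Beta.BlochFibreUniqueness

open scoped ComplexConjugate
open Literature.Probability.LatticeModels (TorusSite Torus.proj Torus.proj_apply)
open AffineAveraging (Site Form0 Form1 Form2 unitVec unitVec_apply dz curv curvAdj codiff₁ box toSite blockSum contourSum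
  contourSum_dz)
open LatticeForm (IsBloch repZ proj_repZ proj_add_zsmul exists_eq_add_zsmul_of_proj_eq quo)

variable {d N : ℕ}

/-! ## §1 Box sums over a fundamental domain of `N•ℤ^d` -/

/-- Sum over the fundamental box `[0, N)^d`, indexed by the discrete torus through integer representatives. [folklore] -/
def bsum (N : ℕ) [NeZero N] (g : Site d → ℂ) : ℂ := ∑ z : TorusSite d N, g (repZ z)

/-- The `AffineAveraging.box`-indexed sum (used by `blockSum`/`contourSum`) is `bsum`. [folklore] -/
theorem sum_box_toSite_eq_bsum [NeZero N] (g : Site d → ℂ) : ∑ b ∈ box d N, g (toSite b) = bsum N g := by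
  unfold bsum
  refine Finset.sum_nbij' (fun b => Torus.proj N (toSite b)) (fun z j => (z j).val) ?_ ?_ ?_ ?_ ?_
  · intro b _; exact Finset.mem_univ _
  · intro z _
    simp only [AffineAveraging.box, Fintype.mem_piFinset, Finset.mem_range]
    exact fun j => ZMod.val_lt (z j)
  · intro b hb
    simp only [AffineAveraging.box, Fintype.mem_piFinset, Finset.mem_range] at hb
    funext j
    simp only [Torus.proj_apply, toSite, Int.cast_natCast, ZMod.val_natCast]
    exact Nat.mod_eq_of_lt (hb j)
  · intro z _
    funext j
    simp only [Torus.proj_apply, toSite, Int.cast_natCast, ZMod.natCast_zmod_val]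
  · intro b hb
    simp only [AffineAveraging.box, Fintype.mem_piFinset, Finset.mem_range] at hb
    congr 1
    funext j
    simp only [repZ, toSite, Torus.proj_apply, Int.cast_natCast, ZMod.val_natCast, Nat.mod_eq_of_lt (hb j)]

/-- `N`-periodicity of a function on `ℤ^d`. [folklore] -/
def IsPer (N : ℕ) (g : Site d → ℂ) : Prop := ∀ x a : Site d, g (x + (N : ℤ) • a) = g x

/-- **SHIFT INVARIANCE**: the box sum of an `N`-periodic function is invariant under any translation. [folklore] -/
theorem bsum_shift [NeZero N] {g : Site d → ℂ} (hg : IsPer N g) (v : Site d) :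
    bsum N (fun x => g (x + v)) = bsum N g := by
  unfold bsum
  have key : ∀ z : TorusSite d N, g (repZ z + v) = g (repZ (z + Torus.proj N v)) := by
    intro z
    have hp : Torus.proj N (repZ z + v) = Torus.proj N (repZ (z + Torus.proj N v)) := by
      rw [PeriodicDescent.proj_add, proj_repZ, proj_repZ]
    obtain ⟨a, ha⟩ := exists_eq_add_zsmul_of_proj_eq hp
    rw [ha, hg]
  simp only [key]
  exact Fintype.sum_equiv (Equiv.addRight (Torus.proj N v)) _ _ (fun z => rfl)

/-- The block index of a box representative is `0`. [folklore] -/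
theorem quo_repZ [NeZero N] (z : TorusSite d N) : quo N (repZ z) = 0 := by
  funext j
  simp only [quo, repZ, Pi.zero_apply]
  exact Int.ediv_eq_zero_of_lt (by positivity) (by exact_mod_cast ZMod.val_lt (z j))

/-- The block index is equivariant under the sublattice: `quo N (x + N•a) = quo N x + a`. [folklore] -/
theorem quo_add_zsmul [NeZero N] (x a : Site d) : quo N (x + (N : ℤ) • a) = quo N x + a := by
  funext j
  have hN : (N : ℤ) ≠ 0 := by exact_mod_cast NeZero.ne N
  simp only [quo, Pi.add_apply, Pi.smul_apply, smul_eq_mul]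
  rw [show x j + (N : ℤ) * a j = x j + a j * (N : ℤ) by ring, Int.add_mul_ediv_right _ _ hN]

/-- A point with box coordinates has block index `0`: `quo N r = 0` if `0 ≤ r j < N`. [folklore] -/
theorem quo_eq_zero_of_lt {r : Site d} (h0 : ∀ j, 0 ≤ r j) (h1 : ∀ j, r j < (N : ℤ)) : quo N r = 0 := by
  funext j
  exact Int.ediv_eq_zero_of_lt (h0 j) (h1 j)

/-! ## §2 Bloch fields: closure under the stencils, periodic products -/

section Bloch

variable {χ : Site d → ℂ}

/-- `IsBloch N χ u` over `ℂ`, unfolded. [folklore] -/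
theorem isBloch_iff {u : Site d → ℂ} : IsBloch N χ u ↔ ∀ x a : Site d, u (x + (N : ℤ) • a) = χ a * u x := by
  simp [IsBloch, smul_eq_mul]

/-- `IsBloch 1 χ g` (coarse fields): `g (y + a) = χ a · g y`. [folklore] -/
theorem isBloch_one_iff' {g : Site d → ℂ} : IsBloch 1 χ g ↔ ∀ y a : Site d, g (y + a) = χ a * g y := by
  simp [IsBloch, smul_eq_mul]

/-- Bloch fields are stable under translation of the argument. [folklore] -/
theorem isBloch_shift {u : Site d → ℂ} (hu : IsBloch N χ u) (v : Site d) : IsBloch N χ (fun x => u (x + v)) := by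
  rw [isBloch_iff] at hu ⊢
  intro x a
  rw [show x + (N : ℤ) • a + v = (x + v) + (N : ℤ) • a by abel, hu]

/-- Sums of `χ`-Bloch fields are `χ`-Bloch. [folklore] -/
theorem isBloch_add {u v : Site d → ℂ} (hu : IsBloch N χ u) (hv : IsBloch N χ v) :
    IsBloch N χ (fun x => u x + v x) := by
  rw [isBloch_iff] at hu hv ⊢
  intro x a; rw [hu, hv]; ring

/-- Differences of `χ`-Bloch fields are `χ`-Bloch. [folklore] -/
theorem isBloch_sub {u v : Site d → ℂ} (hu : IsBloch N χ u) (hv : IsBloch N χ v) :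
    IsBloch N χ (fun x => u x - v x) := by
  rw [isBloch_iff] at hu hv ⊢
  intro x a; rw [hu, hv]; ring

/-- Scalar multiples of `χ`-Bloch fields are `χ`-Bloch. [folklore] -/
theorem isBloch_mul_left {u : Site d → ℂ} (hu : IsBloch N χ u) (c : ℂ) : IsBloch N χ (fun x => c * u x) := by
  rw [isBloch_iff] at hu ⊢
  intro x a; rw [hu]; ring

/-- Finite sums of `χ`-Bloch fields are `χ`-Bloch. [folklore] -/
theorem isBloch_sum {ι : Type*} (s : Finset ι) {u : ι → Site d → ℂ} (hu : ∀ i ∈ s, IsBloch N χ (u i)) :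
    IsBloch N χ (fun x => ∑ i ∈ s, u i x) := by
  rw [isBloch_iff]
  intro x a
  rw [Finset.mul_sum]
  exact Finset.sum_congr rfl (fun i hi => (isBloch_iff.1 (hu i hi)) x a)

/-- The zero field is `χ`-Bloch. [folklore] -/
theorem isBloch_zero' : IsBloch N χ (fun _ : Site d => (0 : ℂ)) := by
  rw [isBloch_iff]; intro x a; simp

/-- Forward difference in direction `i`: `fd i f x = f (x + eᵢ) − f x` (`= dz f i x`). [folklore] -/
def fd (i : Fin d) (f : Site d → ℂ) : Site d → ℂ := fun x => f (x + unitVec i) - f x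

/-- Backward difference (the box adjoint of `fd i`): `bd i u x = u (x − eᵢ) − u x`. [folklore] -/
def bd (i : Fin d) (u : Site d → ℂ) : Site d → ℂ := fun x => u (x - unitVec i) - u x

/-- Forward differences of `χ`-Bloch fields are `χ`-Bloch. [folklore] -/
theorem isBloch_fd {f : Site d → ℂ} (hf : IsBloch N χ f) (i : Fin d) : IsBloch N χ (fd i f) :=
  isBloch_sub (isBloch_shift hf (unitVec i)) hf

/-- Backward differences of `χ`-Bloch fields are `χ`-Bloch. [folklore] -/
theorem isBloch_bd {u : Site d → ℂ} (hu : IsBloch N χ u) (i : Fin d) : IsBloch N χ (bd i u) := by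
  rw [isBloch_iff] at hu ⊢
  intro x a
  simp only [bd]
  rw [show x + (N : ℤ) • a - unitVec i = (x - unitVec i) + (N : ℤ) • a by abel, hu, hu]
  ring

/-- `dz f κ` is the forward difference `fd κ f`. [folklore] -/
theorem dz_eq_fd (f : Form0 d ℂ) (κ : Fin d) : dz f κ = fd κ f := rfl

/-- `codiff₁ A` is the sum of the backward differences of the components. [folklore] -/
theorem codiff₁_eq_sum_bd (A : Form1 d ℂ) : codiff₁ A = fun x => ∑ κ, bd κ (A κ) x := by
  funext x; simp [codiff₁, bd]

/-- `curv A κ l = ∂_κ⁺ A_l − ∂_l⁺ A_κ`. [folklore] -/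
theorem curv_eq_fd (A : Form1 d ℂ) (κ l : Fin d) : curv A κ l = fun x => fd κ (A l) x - fd l (A κ) x := by
  funext x; simp only [curv, fd]; ring

/-- `curvAdj F μ = Σ_κ ∂_κ⁻ F_{κμ} − Σ_l ∂_l⁻ F_{μl}`. [folklore] -/
theorem curvAdj_eq_bd (F : Form2 d ℂ) (μ : Fin d) :
    curvAdj F μ = fun y => (∑ κ, bd κ (F κ μ) y) - ∑ l, bd l (F μ l) y := by
  funext y
  simp only [curvAdj, bd, Finset.sum_sub_distrib]
  ring

/-- `dz` preserves `χ`-Bloch fields (componentwise). [folklore] -/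
theorem isBloch_dz {f : Form0 d ℂ} (hf : IsBloch N χ f) (κ : Fin d) : IsBloch N χ (dz f κ) := isBloch_fd hf κ

/-- `codiff₁` preserves `χ`-Bloch fields. [folklore] -/
theorem isBloch_codiff₁ {A : Form1 d ℂ} (hA : ∀ κ, IsBloch N χ (A κ)) : IsBloch N χ (codiff₁ A) := by
  rw [codiff₁_eq_sum_bd]
  exact isBloch_sum _ (fun κ _ => isBloch_bd (hA κ) κ)

/-- `curv` preserves `χ`-Bloch fields (componentwise). [folklore] -/
theorem isBloch_curv {A : Form1 d ℂ} (hA : ∀ κ, IsBloch N χ (A κ)) (κ l : Fin d) : IsBloch N χ (curv A κ l) := by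
  rw [curv_eq_fd]
  exact isBloch_sub (isBloch_fd (hA l) κ) (isBloch_fd (hA κ) l)

/-- `Δ′ := codiff₁ ∘ dz` preserves Bloch fields. [folklore] -/
theorem isBloch_lapN {f : Form0 d ℂ} (hf : IsBloch N χ f) : IsBloch N χ (codiff₁ (dz f)) :=
  isBloch_codiff₁ (fun κ => isBloch_dz hf κ)

/-- `codiff₁ ∘ dz = −Δ` (lit2's `LatticeForm.lap`). [folklore] -/
theorem codiff₁_dz_eq_neg_lap (f : Form0 d ℂ) (x : Site d) : codiff₁ (dz f) x = - LatticeForm.lap f x := by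
  simp only [codiff₁, dz, LatticeForm.lap, sub_add_cancel, two_smul]
  rw [← Finset.sum_neg_distrib]
  refine Finset.sum_congr rfl (fun κ _ => ?_)
  rw [show (unitVec κ : Site d) = LatticeForm.e κ from rfl]
  ring

/-- Products `conj u · v` of two `χ`-Bloch fields with UNITARY `χ` are `N`-periodic. [folklore] -/
theorem isPer_conj_mul {u v : Site d → ℂ} (hu : IsBloch N χ u) (hv : IsBloch N χ v) (hχ : ∀ a, ‖χ a‖ = 1) :
    IsPer N (fun x => conj (u x) * v x) := by
  intro x a
  dsimp only
  rw [(isBloch_iff.1 hu) x a, (isBloch_iff.1 hv) x a, map_mul]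
  have h1 : conj (χ a) * χ a = 1 := by
    rw [Complex.conj_mul', hχ a]; simp
  calc conj (χ a) * conj (u x) * (χ a * v x) = (conj (χ a) * χ a) * (conj (u x) * v x) := by ring
    _ = conj (u x) * v x := by rw [h1, one_mul]

/-- The block sum of an `N`-Bloch fine 0-form is a `1`-Bloch coarse 0-form. [folklore] -/
theorem isBloch_blockSum {μ : Form0 d ℂ} (hμ : IsBloch N χ μ) : IsBloch 1 χ (blockSum N μ) := by
  rw [isBloch_one_iff']
  intro y a
  simp only [blockSum, Finset.mul_sum]
  refine Finset.sum_congr rfl (fun b _ => ?_)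
  rw [show (N : ℤ) • (y + a) + toSite b = ((N : ℤ) • y + toSite b) + (N : ℤ) • a by rw [smul_add]; abel]
  exact (isBloch_iff.1 hμ) _ a

/-- The straight-contour block sum of an `N`-Bloch fine 1-form is `1`-Bloch (each component). [folklore] -/
theorem isBloch_contourSum {A : Form1 d ℂ} (hA : ∀ κ, IsBloch N χ (A κ)) (κ : Fin d) :
    IsBloch 1 χ (contourSum N A κ) := by
  rw [isBloch_one_iff']
  intro y a
  simp only [contourSum, Finset.mul_sum]
  refine Finset.sum_congr rfl (fun b _ => Finset.sum_congr rfl (fun s _ => ?_))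
  rw [show (N : ℤ) • (y + a) + toSite b + (s : ℤ) • unitVec κ
      = ((N : ℤ) • y + toSite b + (s : ℤ) • unitVec κ) + (N : ℤ) • a by rw [smul_add]; abel]
  exact (isBloch_iff.1 (hA κ)) _ a

/-- A `1`-Bloch coarse field vanishing at `0` vanishes. [folklore] -/
theorem eq_zero_of_isBloch_one {g : Site d → ℂ} (hg : IsBloch 1 χ g) (h0 : g 0 = 0) : g = 0 := by
  funext y
  have := (isBloch_one_iff'.1 hg) 0 y
  rw [zero_add, h0, mul_zero] at this
  exact this

/-- A CONSTANT `1`-Bloch coarse field vanishes if the character is non-trivial. [folklore] -/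
theorem eq_zero_of_isBloch_one_of_const {g : Site d → ℂ} (hg : IsBloch 1 χ g) (hc : ∀ y, g y = g 0) {a₀ : Site d}
    (h₀ : χ a₀ ≠ 1) : g = 0 := by
  have h := (isBloch_one_iff'.1 hg) 0 a₀
  rw [zero_add, hc a₀] at h
  have : (χ a₀ - 1) * g 0 = 0 := by rw [sub_mul, one_mul, ← h, sub_self]
  rcases mul_eq_zero.1 this with h1 | h1
  · exact absurd (sub_eq_zero.1 h1) h₀
  · exact eq_zero_of_isBloch_one hg h1

/-- BLOCH EXTENSION FROM THE BOX: a `χ`-Bloch field vanishing on the fundamental box vanishes. [folklore] -/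
theorem isBloch_eq_zero_of_box [NeZero N] {u : Site d → ℂ} (hu : IsBloch N χ u)
    (h : ∀ z : TorusSite d N, u (repZ z) = 0) : u = 0 := by
  funext x
  have hx : x = repZ (Torus.proj N x) + (N : ℤ) • quo N x := by
    have h1 := LatticeForm.red_add_smul_quo N x
    have h2 : LatticeForm.red N x = repZ (Torus.proj N x) := by
      funext j
      simp only [LatticeForm.red, repZ, Torus.proj_apply]
      rw [ZMod.val_intCast]
    rw [← h2]; exact h1.symm
  rw [hx, (isBloch_iff.1 hu), h, mul_zero, Pi.zero_apply]

end Bloch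

/-! ## §3 The box pairings -/

section Pairing

variable [NeZero N] {χ : Site d → ℂ}

/-- Sesquilinear box pairing of fine 0-forms: `Σ_{x ∈ box} conj (u x) · v x`. [folklore] -/
def ip0 (N : ℕ) [NeZero N] (u v : Form0 d ℂ) : ℂ := bsum N (fun x => conj (u x) * v x)

/-- Box pairing of fine 1-forms. [folklore] -/
def ip1 (N : ℕ) [NeZero N] (A B : Form1 d ℂ) : ℂ := ∑ κ, ip0 N (A κ) (B κ)

/-- Box pairing of fine 2-forms (all ordered index pairs). [folklore] -/
def ip2 (N : ℕ) [NeZero N] (F G : Form2 d ℂ) : ℂ := ∑ κ, ∑ l, ip0 N (F κ l) (G κ l)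

/-- Conjugate symmetry of the box pairing of 0-forms. [folklore] -/
theorem ip0_conj_symm (u v : Form0 d ℂ) : ip0 N u v = conj (ip0 N v u) := by
  simp only [ip0, bsum, map_sum, map_mul, Complex.conj_conj]
  exact Finset.sum_congr rfl (fun z _ => mul_comm _ _)

/-- Conjugate symmetry of the box pairing of 1-forms. [folklore] -/
theorem ip1_conj_symm (A B : Form1 d ℂ) : ip1 N A B = conj (ip1 N B A) := by
  simp only [ip1, map_sum]
  exact Finset.sum_congr rfl (fun κ _ => ip0_conj_symm _ _)

/-- Additivity of `ip0` in the second slot. [folklore] -/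
theorem ip0_add_right (u v w : Form0 d ℂ) : ip0 N u (fun x => v x + w x) = ip0 N u v + ip0 N u w := by
  simp only [ip0, bsum, mul_add, Finset.sum_add_distrib]

/-- `ip0` respects subtraction in the second slot. [folklore] -/
theorem ip0_sub_right (u v w : Form0 d ℂ) : ip0 N u (fun x => v x - w x) = ip0 N u v - ip0 N u w := by
  simp only [ip0, bsum, mul_sub, Finset.sum_sub_distrib]

/-- `ip0` respects subtraction in the first slot. [folklore] -/
theorem ip0_sub_left (u v w : Form0 d ℂ) : ip0 N (fun x => u x - v x) w = ip0 N u w - ip0 N v w := by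
  simp only [ip0, bsum, map_sub, sub_mul, Finset.sum_sub_distrib]

/-- `ip0` of a finite sum in the first slot. [folklore] -/
theorem ip0_sum_left {ι : Type*} (s : Finset ι) (u : ι → Form0 d ℂ) (w : Form0 d ℂ) :
    ip0 N (fun x => ∑ i ∈ s, u i x) w = ∑ i ∈ s, ip0 N (u i) w := by
  simp only [ip0, bsum, map_sum, Finset.sum_mul]
  rw [Finset.sum_comm]

/-- `ip0` of a finite sum in the second slot. [folklore] -/
theorem ip0_sum_right {ι : Type*} (s : Finset ι) (u : Form0 d ℂ) (w : ι → Form0 d ℂ) :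
    ip0 N u (fun x => ∑ i ∈ s, w i x) = ∑ i ∈ s, ip0 N u (w i) := by
  simp only [ip0, bsum, Finset.mul_sum]
  rw [Finset.sum_comm]

/-- `⟨u, u⟩ = Σ ‖u‖²` (a real number). [folklore] -/
theorem ip0_self (u : Form0 d ℂ) : ip0 N u u = ((∑ z : TorusSite d N, ‖u (repZ z)‖ ^ 2 : ℝ) : ℂ) := by
  simp only [ip0, bsum, Complex.conj_mul', Complex.ofReal_sum, Complex.ofReal_pow]

/-- POSITIVITY: `⟨u, u⟩ = 0` iff `u` vanishes on the box. [folklore] -/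
theorem ip0_self_eq_zero_iff (u : Form0 d ℂ) : ip0 N u u = 0 ↔ ∀ z : TorusSite d N, u (repZ z) = 0 := by
  rw [ip0_self, Complex.ofReal_eq_zero]
  constructor
  · intro h z
    have := (Finset.sum_eq_zero_iff_of_nonneg (fun z _ => by positivity)).1 h z (Finset.mem_univ z)
    exact norm_eq_zero.1 (pow_eq_zero_iff two_ne_zero |>.1 this)
  · intro h
    exact Finset.sum_eq_zero (fun z _ => by rw [h z]; simp)

/-- POSITIVITY for 1-forms: `⟨A, A⟩ = 0` iff every component vanishes on the box. [folklore] -/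
theorem ip1_self_eq_zero_iff (A : Form1 d ℂ) : ip1 N A A = 0 ↔ ∀ κ (z : TorusSite d N), A κ (repZ z) = 0 := by
  unfold ip1
  simp only [ip0_self]
  rw [← Complex.ofReal_sum, Complex.ofReal_eq_zero]
  constructor
  · intro h κ z
    have hκ := (Finset.sum_eq_zero_iff_of_nonneg (fun κ _ => by positivity)).1 h κ (Finset.mem_univ κ)
    have := (Finset.sum_eq_zero_iff_of_nonneg (fun z _ => by positivity)).1 hκ z (Finset.mem_univ z)
    exact norm_eq_zero.1 (pow_eq_zero_iff two_ne_zero |>.1 this)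
  · intro h
    exact Finset.sum_eq_zero (fun κ _ => Finset.sum_eq_zero (fun z _ => by rw [h κ z]; simp))

/-- POSITIVITY for 2-forms: `⟨F, F⟩ = 0` iff every component vanishes on the box. [folklore] -/
theorem ip2_self_eq_zero_iff (F : Form2 d ℂ) :
    ip2 N F F = 0 ↔ ∀ κ l (z : TorusSite d N), F κ l (repZ z) = 0 := by
  unfold ip2
  simp only [ip0_self]
  rw [← Finset.sum_congr rfl (fun κ _ => Complex.ofReal_sum _ _), ← Complex.ofReal_sum, Complex.ofReal_eq_zero]
  constructor
  · intro h κ l z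
    have hκ := (Finset.sum_eq_zero_iff_of_nonneg (fun κ _ => by positivity)).1 h κ (Finset.mem_univ κ)
    have hl := (Finset.sum_eq_zero_iff_of_nonneg (fun l _ => by positivity)).1 hκ l (Finset.mem_univ l)
    have := (Finset.sum_eq_zero_iff_of_nonneg (fun z _ => by positivity)).1 hl z (Finset.mem_univ z)
    exact norm_eq_zero.1 (pow_eq_zero_iff two_ne_zero |>.1 this)
  · intro h
    exact Finset.sum_eq_zero (fun κ _ => Finset.sum_eq_zero (fun l _ =>
      Finset.sum_eq_zero (fun z _ => by rw [h κ l z]; simp)))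

/-! ## §4 Adjointness identities on Bloch fields (summation by parts over one box) -/

/-- DIRECTIONAL ADJOINTNESS: `⟨u, ∂ᵢ⁺ f⟩ = ⟨∂ᵢ⁻ u, f⟩` for `χ`-Bloch `u, f` with unitary `χ`. [folklore] -/
theorem ip0_fd {u f : Form0 d ℂ} (hu : IsBloch N χ u) (hf : IsBloch N χ f) (hχ : ∀ a, ‖χ a‖ = 1) (i : Fin d) :
    ip0 N u (fd i f) = ip0 N (bd i u) f := by
  have hshift := bsum_shift (isPer_conj_mul (isBloch_shift hu (-unitVec i)) hf hχ) (unitVec i)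
  -- hshift : bsum (x ↦ conj (u (x + eᵢ - eᵢ)) * f (x + eᵢ)) = bsum (x ↦ conj (u (x - eᵢ)) * f x)
  simp only [ip0, fd, bd, mul_sub, map_sub, sub_mul, bsum, Finset.sum_sub_distrib] at hshift ⊢
  simp only [add_neg_cancel_right] at hshift
  simp only [← sub_eq_add_neg] at hshift
  rw [hshift]

/-- `⟨B, dz f⟩ = ⟨codiff₁ B, f⟩`. [folklore] -/
theorem ip1_dz {B : Form1 d ℂ} {f : Form0 d ℂ} (hB : ∀ κ, IsBloch N χ (B κ)) (hf : IsBloch N χ f)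
    (hχ : ∀ a, ‖χ a‖ = 1) : ip1 N B (dz f) = ip0 N (codiff₁ B) f := by
  unfold ip1
  rw [codiff₁_eq_sum_bd, ip0_sum_left]
  exact Finset.sum_congr rfl (fun κ _ => by rw [dz_eq_fd]; exact ip0_fd (hB κ) hf hχ κ)

/-- `⟨dz f, B⟩ = ⟨f, codiff₁ B⟩`. [folklore] -/
theorem ip1_dz_left {B : Form1 d ℂ} {f : Form0 d ℂ} (hB : ∀ κ, IsBloch N χ (B κ)) (hf : IsBloch N χ f)
    (hχ : ∀ a, ‖χ a‖ = 1) : ip1 N (dz f) B = ip0 N f (codiff₁ B) := by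
  rw [ip1_conj_symm, ip1_dz hB hf hχ, ← ip0_conj_symm]

/-- `Δ′ = codiff₁ ∘ dz` is SYMMETRIC for the box pairing: `⟨u, Δ′ v⟩ = ⟨dz u, dz v⟩ = ⟨Δ′ u, v⟩`. [folklore] -/
theorem ip0_lapN_right {u v : Form0 d ℂ} (hu : IsBloch N χ u) (hv : IsBloch N χ v) (hχ : ∀ a, ‖χ a‖ = 1) :
    ip0 N u (codiff₁ (dz v)) = ip1 N (dz u) (dz v) :=
  (ip1_dz_left (fun κ => isBloch_dz hv κ) hu hχ).symm

/-- `⟨Δ′ u, v⟩ = ⟨dz u, dz v⟩`. [folklore] -/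
theorem ip0_lapN_left {u v : Form0 d ℂ} (hu : IsBloch N χ u) (hv : IsBloch N χ v) (hχ : ∀ a, ‖χ a‖ = 1) :
    ip0 N (codiff₁ (dz u)) v = ip1 N (dz u) (dz v) :=
  (ip1_dz (fun κ => isBloch_dz hu κ) hv hχ).symm

/-- `⟨F, curv A⟩ = ⟨curvAdj F, A⟩` (all ordered pairs). [folklore] -/
theorem ip2_curv {F : Form2 d ℂ} {A : Form1 d ℂ} (hF : ∀ κ l, IsBloch N χ (F κ l)) (hA : ∀ κ, IsBloch N χ (A κ))
    (hχ : ∀ a, ‖χ a‖ = 1) : ip2 N F (curv A) = ip1 N (curvAdj F) A := by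
  unfold ip2 ip1
  have hL : ∀ κ l, ip0 N (F κ l) (curv A κ l) = ip0 N (bd κ (F κ l)) (A l) - ip0 N (bd l (F κ l)) (A κ) := by
    intro κ l
    rw [curv_eq_fd, ip0_sub_right, ← ip0_fd (hF κ l) (hA l) hχ κ, ← ip0_fd (hF κ l) (hA κ) hχ l]
  have hR : ∀ μ, ip0 N (curvAdj F μ) (A μ) = (∑ κ, ip0 N (bd κ (F κ μ)) (A μ)) - ∑ l, ip0 N (bd l (F μ l)) (A μ) := by
    intro μ
    rw [curvAdj_eq_bd, ip0_sub_left, ip0_sum_left, ip0_sum_left]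
  simp only [hL, hR, Finset.sum_sub_distrib]
  rw [Finset.sum_comm]

/-- `⟨A, 𝒬ᵀφ⟩ = Σ_κ conj ((𝒬A) κ 0) · φ κ 0` for `N`-Bloch `A` and `1`-Bloch `φ`. [folklore] -/
theorem ip1_adjContourSum_aux {A : Form1 d ℂ} {φ : Form1 d ℂ} (hA : ∀ κ, IsBloch N χ (A κ))
    (hφ : ∀ κ, IsBloch 1 χ (φ κ)) (hχ : ∀ a, ‖χ a‖ = 1) (κ : Fin d) (s : ℕ) :
    bsum N (fun x => conj (A κ x) * φ κ (quo N (x - (s : ℤ) • unitVec κ)))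
      = conj (bsum N (fun x => A κ (x + (s : ℤ) • unitVec κ))) * φ κ 0 := by
  -- the summand is N-periodic
  have hper : IsPer N (fun x => conj (A κ x) * φ κ (quo N (x - (s : ℤ) • unitVec κ))) := by
    intro x a
    simp only
    rw [(isBloch_iff.1 (hA κ)) x a, map_mul,
      show x + (N : ℤ) • a - (s : ℤ) • unitVec κ = (x - (s : ℤ) • unitVec κ) + (N : ℤ) • a by abel,
      quo_add_zsmul, (isBloch_one_iff'.1 (hφ κ))]
    have h1 : conj (χ a) * χ a = 1 := by rw [Complex.conj_mul', hχ a]; simp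
    calc conj (χ a) * conj (A κ x) * (χ a * φ κ (quo N (x - (s : ℤ) • unitVec κ)))
        = (conj (χ a) * χ a) * (conj (A κ x) * φ κ (quo N (x - (s : ℤ) • unitVec κ))) := by ring
      _ = _ := by rw [h1, one_mul]
  have hs := bsum_shift hper ((s : ℤ) • unitVec κ)
  rw [← hs]
  simp only [add_sub_cancel_right, bsum, quo_repZ, map_sum, Finset.sum_mul]

/-- `⟨A, 𝒬ᵀφ⟩ = Σ_κ conj ((𝒬A) κ 0) · φ κ 0` for `N`-Bloch `A`, `1`-Bloch `φ` and any 1-form `adjQ` given by the adjoint-block-sum formula (instantiated with `adjContourSum N φ` in §6). [folklore] -/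
theorem ip1_adjContourSum' {A : Form1 d ℂ} {φ : Form1 d ℂ} (hA : ∀ κ, IsBloch N χ (A κ))
    (hφ : ∀ κ, IsBloch 1 χ (φ κ)) (hχ : ∀ a, ‖χ a‖ = 1)
    (adjQ : Form1 d ℂ) (hadjQ : ∀ κ x, adjQ κ x = ∑ s ∈ Finset.range N, φ κ (quo N (x - (s : ℤ) • unitVec κ))) :
    ip1 N A adjQ = ∑ κ, conj (contourSum N A κ 0) * φ κ 0 := by
  unfold ip1
  refine Finset.sum_congr rfl (fun κ _ => ?_)
  have h1 : ip0 N (A κ) (adjQ κ)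
      = ∑ s ∈ Finset.range N, bsum N (fun x => conj (A κ x) * φ κ (quo N (x - (s : ℤ) • unitVec κ))) := by
    simp only [ip0, bsum, hadjQ, Finset.mul_sum]
    rw [Finset.sum_comm]
  rw [h1, Finset.sum_congr rfl (fun s _ => ip1_adjContourSum_aux hA hφ hχ κ s), ← Finset.sum_mul, ← map_sum]
  congr 2
  simp only [contourSum, smul_zero, zero_add]
  rw [Finset.sum_comm]
  simp only [← sum_box_toSite_eq_bsum]

end Pairing

/-! ## §5 The adjoint block sum over a general ring -/

/-- The FORMAL ADJOINT of `contourSum N` over any commutative ring (the `ℝ` case is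
`AffineReproduction.contourSumAdj`): `(𝒬ᵀ φ)_κ(x) = Σ_{s<N} φ_κ (block of (x − s e_κ))`. [folklore] -/
def adjContourSum {R : Type*} [AddCommMonoid R] (N : ℕ) (φ : Form1 d R) : Form1 d R :=
  fun κ x => ∑ s ∈ Finset.range N, φ κ (fun i => (x - (s : ℤ) • unitVec κ) i / (N : ℤ))

/-- Over `ℝ` this is `AffineReproduction.contourSumAdj`. [folklore] -/
theorem adjContourSum_real (N : ℕ) (φ : Form1 d ℝ) : adjContourSum N φ = AffineReproduction.contourSumAdj N φ := rfl

/-- `adjContourSum` in terms of the block index `quo`. [folklore] -/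
theorem adjContourSum_apply {R : Type*} [AddCommMonoid R] (N : ℕ) (φ : Form1 d R) (κ : Fin d) (x : Site d) :
    adjContourSum N φ κ x = ∑ s ∈ Finset.range N, φ κ (quo N (x - (s : ℤ) • unitVec κ)) := rfl

/-- FAR-CORNER EVALUATION: at `x = N•y + (N−1)•e_κ` all `N` terms see the block `y`: `(𝒬ᵀφ)_κ(x) = N · φ_κ(y)`. [folklore] -/
theorem adjContourSum_corner [NeZero N] (φ : Form1 d ℂ) (κ : Fin d) (y : Site d) :
    adjContourSum N φ κ ((N : ℤ) • y + ((N : ℤ) - 1) • unitVec κ) = (N : ℂ) * φ κ y := by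
  rw [adjContourSum_apply]
  have hq : ∀ s ∈ Finset.range N, quo N ((N : ℤ) • y + ((N : ℤ) - 1) • unitVec κ - (s : ℤ) • unitVec κ) = y := by
    intro s hs
    rw [Finset.mem_range] at hs
    rw [show (N : ℤ) • y + ((N : ℤ) - 1) • unitVec κ - (s : ℤ) • unitVec κ
        = (((N : ℤ) - 1 - (s : ℤ)) • unitVec κ) + (N : ℤ) • y by module, quo_add_zsmul,
      quo_eq_zero_of_lt, zero_add]
    · intro j
      simp only [Pi.smul_apply, unitVec_apply, smul_eq_mul]
      split_ifs <;> [nlinarith [show (s : ℤ) + 1 ≤ N by exact_mod_cast hs]; simp]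
    · intro j
      simp only [Pi.smul_apply, unitVec_apply, smul_eq_mul]
      have : (0 : ℤ) < N := by exact_mod_cast Nat.pos_of_ne_zero (NeZero.ne N)
      split_ifs <;> nlinarith
  rw [Finset.sum_congr rfl (fun s hs => by rw [hq s hs]), Finset.sum_const, Finset.card_range, nsmul_eq_mul]

/-- `𝒬ᵀ` maps `1`-Bloch coarse 1-forms to `N`-Bloch fine 1-forms. [folklore] -/
theorem isBloch_adjContourSum [NeZero N] {χ : Site d → ℂ} {φ : Form1 d ℂ} (hφ : ∀ κ, IsBloch 1 χ (φ κ)) (κ : Fin d) :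
    IsBloch N χ (adjContourSum N φ κ) := by
  rw [isBloch_iff]
  intro x a
  simp only [adjContourSum_apply, Finset.mul_sum]
  refine Finset.sum_congr rfl (fun s _ => ?_)
  rw [show x + (N : ℤ) • a - (s : ℤ) • unitVec κ = (x - (s : ℤ) • unitVec κ) + (N : ℤ) • a by abel, quo_add_zsmul]
  exact (isBloch_one_iff'.1 (hφ κ)) _ a

/-! ## §6 Uniqueness in every Bloch fibre -/

section Uniqueness

variable [NeZero N] {χ : Site d → ℂ}

/-- The block sum at the origin block is the box sum `bsum`. [folklore] -/
theorem blockSum_zero_eq_bsum (f : Form0 d ℂ) : blockSum N f 0 = bsum N f := by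
  simp only [blockSum, smul_zero, zero_add, sum_box_toSite_eq_bsum]

omit [NeZero N] in
/-- Box representatives of torus points are `toSite` of their digit vectors. [folklore] -/
theorem repZ_eq_toSite (z : TorusSite d N) : repZ z = toSite (fun j => (z j).val) := rfl

/-- The digit vector of a torus point lies in `AffineAveraging.box d N`. [folklore] -/
theorem val_mem_box (z : TorusSite d N) : (fun j => (z j).val) ∈ box d N := by
  simp only [AffineAveraging.box, Fintype.mem_piFinset, Finset.mem_range]
  exact fun j => ZMod.val_lt (z j)

/-- `bsum` of a constant. [folklore] -/
theorem bsum_const (c : ℂ) : bsum N (fun _ : Site d => c) = (N : ℂ) ^ d * c := by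
  simp [bsum, Finset.sum_const, Finset.card_univ, nsmul_eq_mul]

/-- `bsum` respects subtraction. [folklore] -/
theorem bsum_sub (f g : Site d → ℂ) : bsum N (fun x => f x - g x) = bsum N f - bsum N g := by
  simp [bsum, Finset.sum_sub_distrib]

/-- Additivity of `ip1` in the first slot. [folklore] -/
theorem ip1_add_left (B C A : Form1 d ℂ) : ip1 N (B + C) A = ip1 N B A + ip1 N C A := by
  simp [ip1, ip0, bsum, add_mul, map_add, Finset.sum_add_distrib]

/-- A pairing `⟨u, Γ⟩` with `u` of zero box sum against a function CONSTANT on the box vanishes. [folklore] -/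
theorem ip0_eq_zero_of_boxConst {u Γ : Form0 d ℂ} (hu : bsum N u = 0) (hΓ : ∀ z : TorusSite d N, Γ (repZ z) = Γ 0) :
    ip0 N u Γ = 0 := by
  have : ip0 N u Γ = conj (bsum N u) * Γ 0 := by
    simp only [ip0, bsum, hΓ, map_sum, Finset.sum_mul]
  rw [this, hu, map_zero, zero_mul]

/-- STEP 1: pairing (EL) with `A` kills the curvature. [folklore] -/
theorem curv_eq_zero_of_system (hχ : ∀ a, ‖χ a‖ = 1) {A φ : Form1 d ℂ} {μ : Form0 d ℂ}
    (hA : ∀ κ, IsBloch N χ (A κ)) (hφ : ∀ κ, IsBloch 1 χ (φ κ)) (hμ : IsBloch N χ μ)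
    (hEL : curvAdj (curv A) = adjContourSum N φ + dz (codiff₁ (dz μ)))
    (hQ : ∀ κ, contourSum N A κ 0 = 0)
    (hG : ∀ z : TorusSite d N, codiff₁ (dz (codiff₁ A)) (repZ z) = codiff₁ (dz (codiff₁ A)) 0)
    (hM : bsum N μ = 0) : curv A = 0 := by
  have h1 : ip2 N (curv A) (curv A) = ip1 N (curvAdj (curv A)) A := ip2_curv (isBloch_curv hA) hA hχ
  rw [hEL, ip1_add_left] at h1
  -- the constraint term
  have hT1 : ip1 N (adjContourSum N φ) A = 0 := by
    rw [ip1_conj_symm, ip1_adjContourSum' hA hφ hχ (adjContourSum N φ) (fun κ x => adjContourSum_apply N φ κ x)]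
    simp [hQ]
  -- the gauge term
  have hT2 : ip1 N (dz (codiff₁ (dz μ))) A = 0 := by
    rw [ip1_dz_left hA (isBloch_lapN hμ) hχ, ip0_lapN_left hμ (isBloch_codiff₁ hA) hχ,
      ← ip0_lapN_right hμ (isBloch_codiff₁ hA) hχ]
    exact ip0_eq_zero_of_boxConst hM hG
  rw [hT1, hT2, add_zero] at h1
  have hbox := (ip2_self_eq_zero_iff (curv A)).1 h1
  funext κ l
  rw [Pi.zero_apply, Pi.zero_apply]
  exact isBloch_eq_zero_of_box (isBloch_curv hA κ l) (hbox κ l)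

omit [NeZero N] in
/-- lit2's unit vector `LatticeForm.e κ` is `AffineAveraging.unitVec κ` (both `Pi.single κ 1`). [folklore] -/
theorem e_eq_unitVec (κ : Fin d) : (LatticeForm.e κ : Site d) = unitVec κ := rfl

omit [NeZero N] in
/-- The 1-cochain dictionary `θ x i := A i x`: `LatticeForm.d₁ θ` is `curv A`. [folklore] -/
theorem d₁_swap_eq_curv (A : Form1 d ℂ) (x : Site d) (i j : Fin d) :
    LatticeForm.d₁ (fun x i => A i x) x i j = curv A i j x := rfl

/-- STEP 2: a curvature-free Bloch 1-form with vanishing block sums is EXACT with a Bloch primitive of zero box sum —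
twisted `H¹ = 0` (`exists_isBloch_primitive`) resp. `const + exact` (`exists_const_add_d₀_of_periodic`), the constant /
the box mean being killed by the constraint through `contourSum_dz`. [folklore] -/
theorem exists_primitive {A : Form1 d ℂ} (hA : ∀ κ, IsBloch N χ (A κ)) (hc : curv A = 0)
    (hQ : ∀ κ, contourSum N A κ 0 = 0) :
    ∃ lam : Form0 d ℂ, IsBloch N χ lam ∧ A = dz lam ∧ bsum N lam = 0 := by
  have hNC : (N : ℂ) ≠ 0 := by exact_mod_cast NeZero.ne N
  set θ : Site d → Fin d → ℂ := fun x i => A i x with hθ_def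
  have hcl : LatticeForm.d₁ θ = 0 := by
    funext x i j
    rw [d₁_swap_eq_curv, hc]; rfl
  -- the block sums of `A` vanish identically (Bloch/1, zero at the origin)
  have hQall : ∀ κ, contourSum N A κ = 0 := fun κ => eq_zero_of_isBloch_one (isBloch_contourSum hA κ) (hQ κ)
  by_cases htriv : ∀ a, χ a = 1
  · -- trivial character: `A` is `N`-periodic
    have hper : ∀ x a : Site d, θ (x + (N : ℤ) • a) = θ x := by
      intro x a; funext i
      have := (isBloch_iff.1 (hA i)) x a
      rw [htriv a, one_mul] at this
      exact this
    obtain ⟨c, μ0, hμ0, hθ, -⟩ := LatticeForm.exists_const_add_d₀_of_periodic (𝕜 := ℂ) hNC hper hcl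
    have hAeq : ∀ κ x, A κ x = c κ + dz μ0 κ x := by
      intro κ x
      have := congrFun (congrFun hθ x) κ
      simpa [hθ_def, LatticeForm.d₀, dz, e_eq_unitVec] using this
    -- the block sums of a periodic 0-form are all equal, so `𝒬 (dz μ0) = dz (blockSum μ0) = 0`
    have hbs : ∀ y, blockSum N μ0 y = blockSum N μ0 0 := by
      intro y
      simp only [blockSum, smul_zero, zero_add]
      refine Finset.sum_congr rfl (fun b _ => ?_)
      rw [show (N : ℤ) • y + toSite b = toSite b + (N : ℤ) • y by abel, hμ0]
    have hQdz : ∀ κ, contourSum N (dz μ0) κ 0 = 0 := by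
      intro κ
      rw [contourSum_dz]
      simp only [dz, hbs, sub_self]
    -- hence the constant part vanishes
    have hc0 : ∀ κ, c κ = 0 := by
      intro κ
      have h := hQ κ
      have hsplit : contourSum N A κ 0 = ∑ b ∈ box d N, ∑ s ∈ Finset.range N, c κ + contourSum N (dz μ0) κ 0 := by
        simp only [contourSum, hAeq, Finset.sum_add_distrib]
      rw [hsplit, hQdz κ, add_zero, Finset.sum_const, Finset.sum_const, Finset.card_range, smul_smul,
        nsmul_eq_mul] at h
      have hcard : ((box d N).card * N : ℕ) ≠ 0 := by
        have : (box d N).card = N ^ d := by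
          simp [AffineAveraging.box, Fintype.card_piFinset, Finset.card_range, Finset.prod_const, Finset.card_univ,
            Fintype.card_fin]
        rw [this, ← pow_succ]
        exact pow_ne_zero _ (NeZero.ne N)
      rcases mul_eq_zero.1 h with h1 | h1
      · exact absurd (by exact_mod_cast h1) hcard
      · exact h1
    -- normalise the primitive to zero box mean
    set m : ℂ := bsum N μ0 / (N : ℂ) ^ d with hm
    refine ⟨fun x => μ0 x - m, ?_, ?_, ?_⟩
    · rw [isBloch_iff]
      intro x a
      rw [htriv a, one_mul, hμ0]
    · funext κ x
      rw [hAeq, hc0, zero_add]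
      simp [dz]
    · rw [bsum_sub, bsum_const, hm, mul_div_cancel₀ _ (pow_ne_zero d hNC), sub_self]
  · -- non-trivial character: twisted H¹ = 0
    push Not at htriv
    obtain ⟨a₀, ha₀⟩ := htriv
    have hθB : IsBloch N χ θ := by
      intro x a; funext i
      simp only [hθ_def, Pi.smul_apply, smul_eq_mul]
      exact (isBloch_iff.1 (hA i)) x a
    obtain ⟨lam, hlamB, hlam⟩ := LatticeForm.exists_isBloch_primitive hθB hcl ha₀
    have hlamB' : IsBloch N χ lam := by
      rw [isBloch_iff]; intro x a; simpa [smul_eq_mul] using hlamB x a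
    have hAeq : A = dz lam := by
      funext κ x
      have := congrFun (congrFun hlam x) κ
      simpa [hθ_def, LatticeForm.d₀, dz, e_eq_unitVec] using this.symm
    refine ⟨lam, hlamB', hAeq, ?_⟩
    -- `𝒬 A = dz (blockSum lam) = 0`, so `blockSum lam` is a CONSTANT Bloch/1 field, hence zero
    have hdz : dz (blockSum N lam) = 0 := by
      rw [← contourSum_dz, ← hAeq]
      funext κ; exact hQall κ
    have hconst : ∀ y, blockSum N lam y = blockSum N lam 0 := fun y => PeriodicDescent.const_of_dz_eq_zero _ hdz y
    have hzero := eq_zero_of_isBloch_one_of_const (isBloch_blockSum hlamB') hconst ha₀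
    rw [← blockSum_zero_eq_bsum, hzero, Pi.zero_apply]

/-- STEP 3 (the gauge): a Bloch `λ` of zero box sum with `Δ′Δ′λ` constant on the box is discrete-HARMONIC. [folklore] -/
theorem lap_eq_zero_of_gauge (hχ : ∀ a, ‖χ a‖ = 1) {lam : Form0 d ℂ} (hlam : IsBloch N χ lam) (h0 : bsum N lam = 0)
    (hG : ∀ z : TorusSite d N, codiff₁ (dz (codiff₁ (dz lam))) (repZ z) = codiff₁ (dz (codiff₁ (dz lam))) 0) :
    ∀ x, LatticeForm.lap lam x = 0 := by
  have h1 : ip0 N lam (codiff₁ (dz (codiff₁ (dz lam)))) = 0 := ip0_eq_zero_of_boxConst h0 hG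
  rw [ip0_lapN_right hlam (isBloch_lapN hlam) hχ, ← ip0_lapN_left hlam (isBloch_lapN hlam) hχ,
    ip0_self_eq_zero_iff] at h1
  have hz := isBloch_eq_zero_of_box (isBloch_lapN hlam) h1
  intro x
  have := congrFun hz x
  rw [codiff₁_dz_eq_neg_lap, Pi.zero_apply, neg_eq_zero] at this
  exact this

/-- A discrete-harmonic Bloch field with unitary character has zero gradient (it vanishes for a non-trivial character,
`IsBloch.eq_zero_of_lap_eq_zero`; it is constant for the trivial one, `apply_eq_of_periodic_of_lap_eq_zero`). [folklore] -/
theorem dz_eq_zero_of_lap (hχ : ∀ a, ‖χ a‖ = 1) {lam : Form0 d ℂ} (hlam : IsBloch N χ lam)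
    (hh : ∀ x, LatticeForm.lap lam x = 0) : dz lam = 0 := by
  have hN : 0 < N := Nat.pos_of_ne_zero (NeZero.ne N)
  by_cases htriv : ∀ a, χ a = 1
  · have hper : ∀ x a : Site d, lam (x + (N : ℤ) • a) = lam x := by
      intro x a
      have := (isBloch_iff.1 hlam) x a
      rw [htriv a, one_mul] at this; exact this
    funext κ x
    simp only [dz, Pi.zero_apply]
    rw [LatticeForm.apply_eq_of_periodic_of_lap_eq_zero hN hper hh (x + unitVec κ) x, sub_self]
  · push Not at htriv
    obtain ⟨a₀, ha₀⟩ := htriv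
    rw [LatticeForm.IsBloch.eq_zero_of_lap_eq_zero hN hlam hχ hh ha₀]
    funext κ x; simp [dz]

/-- … and it VANISHES if in addition its box sum is zero. [folklore] -/
theorem eq_zero_of_lap_of_bsum (hχ : ∀ a, ‖χ a‖ = 1) {μ : Form0 d ℂ} (hμ : IsBloch N χ μ)
    (hh : ∀ x, LatticeForm.lap μ x = 0) (h0 : bsum N μ = 0) : μ = 0 := by
  have hN : 0 < N := Nat.pos_of_ne_zero (NeZero.ne N)
  have hNC : (N : ℂ) ≠ 0 := by exact_mod_cast NeZero.ne N
  by_cases htriv : ∀ a, χ a = 1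
  · have hper : ∀ x a : Site d, μ (x + (N : ℤ) • a) = μ x := by
      intro x a
      have := (isBloch_iff.1 hμ) x a
      rw [htriv a, one_mul] at this; exact this
    have hc : ∀ x, μ x = μ 0 := fun x => LatticeForm.apply_eq_of_periodic_of_lap_eq_zero hN hper hh x 0
    have hsum : bsum N μ = (N : ℂ) ^ d * μ 0 := by
      rw [show bsum N μ = bsum N (fun _ => μ 0) by unfold bsum; exact Finset.sum_congr rfl (fun z _ => hc _),
        bsum_const]
    rw [hsum] at h0
    have hμ0 : μ 0 = 0 := by
      rcases mul_eq_zero.1 h0 with h | h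
      · exact absurd h (pow_ne_zero d hNC)
      · exact h
    funext x; rw [hc x, hμ0, Pi.zero_apply]
  · push Not at htriv
    obtain ⟨a₀, ha₀⟩ := htriv
    exact LatticeForm.IsBloch.eq_zero_of_lap_eq_zero hN hμ hχ hh ha₀

/-- `dz 0 = 0` (over `ℂ`). [folklore] -/
theorem dz_zero' : dz (0 : Form0 d ℂ) = 0 := by funext κ x; simp [dz]
/-- `codiff₁ 0 = 0` (over `ℂ`). [folklore] -/
theorem codiff₁_zero' : codiff₁ (0 : Form1 d ℂ) = 0 := by funext x; simp [codiff₁]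
/-- `curv 0 = 0` (over `ℂ`). [folklore] -/
theorem curv_zero' : curv (0 : Form1 d ℂ) = 0 := by funext κ l x; simp [curv]
/-- `curvAdj 0 = 0` (over `ℂ`). [folklore] -/
theorem curvAdj_zero' : curvAdj (0 : Form2 d ℂ) = 0 := by funext μ y; simp [curvAdj]

/-- **BLOCH-FIBRE UNIQUENESS.**  In every fibre (every unitary `χ`) the homogeneous gauge-fixed KKT system
(EL) + (Q) + (G) + (M) has only the trivial `χ`-Bloch solution. [folklore] -/
theorem blochFibre_uniqueness (hχ : ∀ a, ‖χ a‖ = 1) {A φ : Form1 d ℂ} {μ : Form0 d ℂ}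
    (hA : ∀ κ, IsBloch N χ (A κ)) (hφ : ∀ κ, IsBloch 1 χ (φ κ)) (hμ : IsBloch N χ μ)
    (hEL : curvAdj (curv A) = adjContourSum N φ + dz (codiff₁ (dz μ)))
    (hQ : ∀ κ, contourSum N A κ 0 = 0)
    (hG : ∀ b ∈ box d N, codiff₁ (dz (codiff₁ A)) (toSite b) = codiff₁ (dz (codiff₁ A)) 0)
    (hM : blockSum N μ 0 = 0) :
    A = 0 ∧ φ = 0 ∧ μ = 0 := by
  have hNC : (N : ℂ) ≠ 0 := by exact_mod_cast NeZero.ne N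
  have hG' : ∀ z : TorusSite d N, codiff₁ (dz (codiff₁ A)) (repZ z) = codiff₁ (dz (codiff₁ A)) 0 :=
    fun z => by rw [repZ_eq_toSite]; exact hG _ (val_mem_box z)
  have hM' : bsum N μ = 0 := by rw [← blockSum_zero_eq_bsum]; exact hM
  -- Step 1 & 2: `A = dz λ`, `λ` Bloch with zero box sum
  have hc := curv_eq_zero_of_system hχ hA hφ hμ hEL hQ hG' hM'
  obtain ⟨lam, hlam, hAeq, hlam0⟩ := exists_primitive hA hc hQ
  -- Step 3: the gauge makes `λ` harmonic, hence `A = dz λ = 0`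
  have hGlam : ∀ z : TorusSite d N,
      codiff₁ (dz (codiff₁ (dz lam))) (repZ z) = codiff₁ (dz (codiff₁ (dz lam))) 0 := by
    intro z; have := hG' z; rw [hAeq] at this; exact this
  have hA0 : A = 0 := by
    rw [hAeq]; exact dz_eq_zero_of_lap hχ hlam (lap_eq_zero_of_gauge hχ hlam hlam0 hGlam)
  -- Step 4: multipliers
  have hE : adjContourSum N φ + dz (codiff₁ (dz μ)) = 0 := by
    rw [← hEL, hA0, curv_zero', curvAdj_zero']
  have hpair : ip1 N (dz μ) (adjContourSum N φ + dz (codiff₁ (dz μ))) = 0 := by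
    rw [hE]; simp [ip1, ip0, bsum]
  have hT1 : ip1 N (dz μ) (adjContourSum N φ) = 0 := by
    rw [ip1_adjContourSum' (fun κ => isBloch_dz hμ κ) hφ hχ (adjContourSum N φ) (fun κ x => adjContourSum_apply N φ κ x)]
    have hbs : blockSum N μ = 0 := eq_zero_of_isBloch_one (isBloch_blockSum hμ) hM
    simp [contourSum_dz, hbs, dz]
  have hsplit : ip1 N (dz μ) (adjContourSum N φ + dz (codiff₁ (dz μ)))
      = ip1 N (dz μ) (adjContourSum N φ) + ip1 N (dz μ) (dz (codiff₁ (dz μ))) := by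
    simp [ip1, ip0, bsum, mul_add, Finset.sum_add_distrib]
  rw [hsplit, hT1, zero_add, ← ip0_lapN_left hμ (isBloch_lapN hμ) hχ, ip0_self_eq_zero_iff] at hpair
  have hlapμ : ∀ x, LatticeForm.lap μ x = 0 := by
    intro x
    have := congrFun (isBloch_eq_zero_of_box (isBloch_lapN hμ) hpair) x
    rw [codiff₁_dz_eq_neg_lap, Pi.zero_apply, neg_eq_zero] at this
    exact this
  have hμ0 : μ = 0 := eq_zero_of_lap_of_bsum hχ hμ hlapμ hM'
  have hφ0 : φ = 0 := by
    rw [hμ0, dz_zero', codiff₁_zero', dz_zero', add_zero] at hE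
    funext κ y
    have h := congrFun (congrFun hE κ) ((N : ℤ) • y + ((N : ℤ) - 1) • unitVec κ)
    rw [adjContourSum_corner, Pi.zero_apply, Pi.zero_apply] at h
    rcases mul_eq_zero.1 h with h1 | h1
    · exact absurd h1 hNC
    · rw [h1, Pi.zero_apply, Pi.zero_apply]
  exact ⟨hA0, hφ0, hμ0⟩

/-- COROLLARY (multiplier-free form): under the same hypotheses the fine field alone vanishes. [folklore] -/
theorem blochFibre_field_eq_zero (hχ : ∀ a, ‖χ a‖ = 1) {A φ : Form1 d ℂ} {μ : Form0 d ℂ}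
    (hA : ∀ κ, IsBloch N χ (A κ)) (hφ : ∀ κ, IsBloch 1 χ (φ κ)) (hμ : IsBloch N χ μ)
    (hEL : curvAdj (curv A) = adjContourSum N φ + dz (codiff₁ (dz μ)))
    (hQ : ∀ κ, contourSum N A κ 0 = 0)
    (hG : ∀ b ∈ box d N, codiff₁ (dz (codiff₁ A)) (toSite b) = codiff₁ (dz (codiff₁ A)) 0)
    (hM : blockSum N μ 0 = 0) : A = 0 :=
  (blochFibre_uniqueness hχ hA hφ hμ hEL hQ hG hM).1

/-- `curv` is compatible with subtraction (over `ℂ`). [folklore] -/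
theorem curv_sub' (A A' : Form1 d ℂ) : curv (A - A') = curv A - curv A' := by
  funext κ l x; simp only [curv, Pi.sub_apply]; ring

/-- `curvAdj` is compatible with subtraction (over `ℂ`). [folklore] -/
theorem curvAdj_sub' (F G : Form2 d ℂ) : curvAdj (F - G) = curvAdj F - curvAdj G := by
  funext μ y; simp only [curvAdj, Pi.sub_apply, Finset.sum_sub_distrib]; ring

/-- `dz` is compatible with subtraction (over `ℂ`). [folklore] -/
theorem dz_sub' (f g : Form0 d ℂ) : dz (f - g) = dz f - dz g := by
  funext κ x; simp only [dz, Pi.sub_apply]; ring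

/-- `codiff₁` is compatible with subtraction (over `ℂ`). [folklore] -/
theorem codiff₁_sub' (A A' : Form1 d ℂ) : codiff₁ (A - A') = codiff₁ A - codiff₁ A' := by
  funext x; simp only [codiff₁, Pi.sub_apply, Finset.sum_sub_distrib]; ring

omit [NeZero N] in
/-- `adjContourSum` is compatible with subtraction (over `ℂ`). [folklore] -/
theorem adjContourSum_sub' (φ φ' : Form1 d ℂ) :
    adjContourSum N (φ - φ') = adjContourSum N φ - adjContourSum N φ' := by
  funext κ x; simp only [adjContourSum_apply, Pi.sub_apply, Finset.sum_sub_distrib]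

omit [NeZero N] in
/-- `contourSum` is compatible with subtraction (over `ℂ`). [folklore] -/
theorem contourSum_sub' (A A' : Form1 d ℂ) (κ : Fin d) (y : Site d) :
    contourSum N (A - A') κ y = contourSum N A κ y - contourSum N A' κ y := by
  simp only [contourSum, Pi.sub_apply, Finset.sum_sub_distrib]

omit [NeZero N] in
/-- `blockSum` is compatible with subtraction (over `ℂ`). [folklore] -/
theorem blockSum_sub' (f g : Form0 d ℂ) (y : Site d) : blockSum N (f - g) y = blockSum N f y - blockSum N g y := by
  simp only [blockSum, Pi.sub_apply, Finset.sum_sub_distrib]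

/-- INHOMOGENEOUS COROLLARY: two `χ`-Bloch solutions of the system with the SAME data (source `J`, block sums,
gauge datum, multiplier block mean) coincide. [folklore] -/
theorem blochFibre_solution_unique (hχ : ∀ a, ‖χ a‖ = 1) {A A' φ φ' : Form1 d ℂ} {μ μ' : Form0 d ℂ} {J : Form1 d ℂ}
    (hA : ∀ κ, IsBloch N χ (A κ)) (hφ : ∀ κ, IsBloch 1 χ (φ κ)) (hμ : IsBloch N χ μ)
    (hA' : ∀ κ, IsBloch N χ (A' κ)) (hφ' : ∀ κ, IsBloch 1 χ (φ' κ)) (hμ' : IsBloch N χ μ')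
    (hEL : curvAdj (curv A) = adjContourSum N φ + dz (codiff₁ (dz μ)) + J)
    (hEL' : curvAdj (curv A') = adjContourSum N φ' + dz (codiff₁ (dz μ')) + J)
    (hQ : ∀ κ, contourSum N A κ 0 = contourSum N A' κ 0)
    (hG : ∀ b ∈ box d N, codiff₁ (dz (codiff₁ A)) (toSite b) - codiff₁ (dz (codiff₁ A')) (toSite b)
      = codiff₁ (dz (codiff₁ A)) 0 - codiff₁ (dz (codiff₁ A')) 0)
    (hM : blockSum N μ 0 = blockSum N μ' 0) :
    A = A' ∧ φ = φ' ∧ μ = μ' := by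
  have key := blochFibre_uniqueness (N := N) hχ (A := A - A') (φ := φ - φ') (μ := μ - μ')
    (fun κ => isBloch_sub (hA κ) (hA' κ)) (fun κ => isBloch_sub (hφ κ) (hφ' κ)) (isBloch_sub hμ hμ') ?_ ?_ ?_ ?_
  · exact ⟨sub_eq_zero.1 key.1, sub_eq_zero.1 key.2.1, sub_eq_zero.1 key.2.2⟩
  · rw [curv_sub', curvAdj_sub', hEL, hEL', adjContourSum_sub', dz_sub', codiff₁_sub', dz_sub']
    abel
  · intro κ
    rw [contourSum_sub', hQ κ, sub_self]
  · intro b hb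
    rw [codiff₁_sub', dz_sub', codiff₁_sub', Pi.sub_apply, Pi.sub_apply]
    exact hG b hb
  · rw [blockSum_sub', hM, sub_self]

end Uniqueness

end Literature.MathematicalPhysics.QuantumFieldTheory.Balaban1983to89.Beta.BlochFibreUniqueness
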